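import Literature.NumberTheory.Transcendental.PadicLogAlgClProofs
import Mathlib.FieldTheory.Minpoly.Finite
import HarnessLib

/-!
# Norms in `ℚ̄_p` of integral elements: discreteness below `1`, units of an order, and the
# Jacobson radical of an order goes to the open unit ball

Support file 9 of the brick «(b) weak Leopoldt over `𝔎_∞`: `Ē_∞ ↪ U_v`» (cell bsd-print-cf2, LEAD
ruling B23 §4 (b)) for crux `PrintCf2RubinValueTwo.TwoVariableMainConjAtSplitTwo`
(stmt-BirchSwinnertonDyer-23720). Namespace `…Theorems.PrintCf2.LeopoldtAtV`.

To read Rubin's filtration `U^{(k)}(F) = 1 + rad^k` of the semi-local units of `F ⊗_K K_𝔭`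
(tree: `Semilocal.unitsOfLevel`, `Semilocal.radical` = Jacobson radical of the maximal
`𝒪_𝔭`-order) through an embedding `Φ : F ⊗_K K_𝔭 → ℚ̄_p` one needs three elementary facts about
the spectral norm `‖·‖` of `ℚ̄_p = PadicAlgCl p`, proved here for an ABSTRACT commutative ring `L`
with a ring map `Φ : L →+* ℚ̄_p`, a "ring of integers" `i : A →+* L` whose image has norm `≤ 1`
and detects units by `‖Φ(i a)‖ = 1`, and the order `R = {x : x integral over i(A)}`:

* §1 `norm_le_one_of_isIntegralElem` — `‖Φ x‖ ≤ 1` on `R` (a root of a monic polynomial with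
  coefficients of norm `≤ 1` has norm `≤ 1`); `norm_eq_one_of_mul_eq_one` — units of `R` go to
  norm `1`;
* §2 `norm_lt_one_of_forall_isUnit_one_add_mul` — an `x ∈ R` with `1 + xy ∈ R^×` for all `y ∈ R`
  (i.e. `x` in the JACOBSON RADICAL of `R`) has `‖Φ x‖ < 1`. Proof (no residue fields): if
  `‖Φ x‖ = 1` and `∑ cᵢ zⁱ = 0` (`z = Φ x`, `cᵢ = Φ(i aᵢ)`, `c_d = 1`), let `s` be the least index
  with `‖c_s‖ = 1`; then `‖c_s + z·w‖ < 1` for `w = ∑_{i>s} cᵢ z^{i-s-1} = Φ(W)`, `W ∈ R`, and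
  `y = -… ` no: `y = i(a_s⁻¹)·W` gives `Φ(1 + x y) = Φ(i a_s⁻¹)(c_s + z w)` of norm `< 1`, while a
  unit of `R` has norm `1`;
* §3 `norm_le_pow_of_mem_pow` — if `‖Φ‖ ≤ ρ` on an ideal `J` then `‖Φ‖ ≤ ρ^k` on `J^k`
  (ultrametric inequality);
* §4 `norm_pow_finrank_le_inv_of_norm_lt_one` — DISCRETENESS: an element of a finite-dimensional
  `ℚ_p`-subalgebra `S ⊆ ℚ̄_p` of norm `< 1` has `‖z‖^{dim S} ≤ p⁻¹` (`‖z‖^{deg} = ‖a₀‖ ∈ p^ℤ` for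
  the minimal polynomial, tree `IwasawaLog.norm_pow_natDegree_minpoly`).

References: folklore (valuation theory of `ℚ̄_p`); J.-P. Serre, *Local Fields*, Ch. II §2;
L. C. Washington, GTM 83, §5.5.
-/

noncomputable section

set_option linter.dupNamespace false -- `Summit.BirchSwinnertonDyer.BirchSwinnertonDyer` (summit = problem) is the tree's layout
set_option autoImplicit false

open Polynomial Module
open Literature.NumberTheory.Transcendental

namespace Summit.BirchSwinnertonDyer.BirchSwinnertonDyer.Theorems.PrintCf2.LeopoldtAtV

variable {p : ℕ} [Fact p.Prime]

/-! ### §1. Integral elements have norm `≤ 1`; units of the order have norm `1` -/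

section Order

variable {A L : Type*} [CommRing A] [CommRing L] (Φ : L →+* PadicAlgCl p) (i : A →+* L)

/-- Strict ultrametric inequality for finite sums in `ℚ̄_p`: if every term has norm `< C`
(`0 < C`) then so does the sum. [folklore] -/
theorem norm_sum_lt_of_forall_lt {ι : Type*} (t : Finset ι) (a : ι → PadicAlgCl p) {C : ℝ}
    (hC : 0 < C) (ha : ∀ j ∈ t, ‖a j‖ < C) : ‖∑ j ∈ t, a j‖ < C := by
  classical
  induction t using Finset.induction_on with
  | empty => simpa using hC
  | insert j t hj ih =>
    rw [Finset.sum_insert hj]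
    refine (IsUltrametricDist.norm_add_le_max _ _).trans_lt (max_lt (ha j (Finset.mem_insert_self j t)) ?_)
    exact ih fun i hi ↦ ha i (Finset.mem_insert_of_mem hi)

/-- A root `z ∈ ℚ̄_p` of a monic polynomial whose coefficients have norm `≤ 1` has norm `≤ 1`
(ultrametric: otherwise the top term dominates). [folklore] -/
theorem norm_le_one_of_sum_eq_zero {d : ℕ} (c : ℕ → PadicAlgCl p) (hc : ∀ j < d, ‖c j‖ ≤ 1)
    {z : PadicAlgCl p} (hz : z ^ d + ∑ j ∈ Finset.range d, c j * z ^ j = 0) : ‖z‖ ≤ 1 := by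
  by_contra h
  rw [not_le] at h
  have hz0 : 0 < ‖z‖ := one_pos.trans h
  -- every lower term is strictly smaller than `‖z‖^d`
  have hlt : ∀ j ∈ Finset.range d, ‖c j * z ^ j‖ < ‖z‖ ^ d := by
    intro j hj
    rw [Finset.mem_range] at hj
    rw [norm_mul, norm_pow]
    calc ‖c j‖ * ‖z‖ ^ j ≤ 1 * ‖z‖ ^ j := by gcongr; exact hc j hj
      _ = ‖z‖ ^ j := one_mul _
      _ < ‖z‖ ^ d := pow_lt_pow_right₀ h hj
  have hsum : ‖∑ j ∈ Finset.range d, c j * z ^ j‖ < ‖z‖ ^ d :=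
    norm_sum_lt_of_forall_lt _ _ (pow_pos hz0 d) hlt
  have heq : z ^ d = -∑ j ∈ Finset.range d, c j * z ^ j := eq_neg_of_add_eq_zero_left hz
  have : ‖z ^ d‖ < ‖z‖ ^ d := by rw [heq, norm_neg]; exact hsum
  rw [norm_pow] at this
  exact lt_irrefl _ this

variable {Φ i}

/-- **Elements integral over `i(A)` have norm `≤ 1` under `Φ`**, provided `‖Φ(i a)‖ ≤ 1` for all
`a ∈ A`. [folklore] -/
theorem norm_le_one_of_isIntegralElem (hA : ∀ a : A, ‖Φ (i a)‖ ≤ 1) {x : L}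
    (hx : i.IsIntegralElem x) : ‖Φ x‖ ≤ 1 := by
  obtain ⟨P, hP, hPx⟩ := hx
  refine norm_le_one_of_sum_eq_zero (d := P.natDegree) (fun j ↦ Φ (i (P.coeff j)))
    (fun j _ ↦ hA _) ?_
  have h := congrArg Φ hPx
  rw [eval₂_eq_sum_range, map_zero, Finset.sum_range_succ, map_add, map_sum] at h
  rw [add_comm]
  convert h using 2
  · refine Finset.sum_congr rfl fun j _ ↦ ?_
    rw [map_mul, map_pow]
  · rw [map_mul, map_pow, show P.coeff P.natDegree = 1 from hP, map_one, map_one, one_mul]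

/-- If `x·y = 1` with `‖Φ x‖ ≤ 1` and `‖Φ y‖ ≤ 1` then `‖Φ x‖ = 1`. [folklore] -/
theorem norm_eq_one_of_mul_eq_one {x y : L} (hx : ‖Φ x‖ ≤ 1) (hy : ‖Φ y‖ ≤ 1)
    (hxy : x * y = 1) : ‖Φ x‖ = 1 := by
  have h : ‖Φ x‖ * ‖Φ y‖ = 1 := by rw [← norm_mul, ← map_mul, hxy, map_one, norm_one]
  refine le_antisymm hx ?_
  by_contra hlt
  rw [not_le] at hlt
  have : ‖Φ x‖ * ‖Φ y‖ < 1 * 1 :=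
    mul_lt_mul_of_lt_of_le_of_nonneg_of_pos hlt hy (norm_nonneg _) one_pos
  rw [h, one_mul] at this
  exact lt_irrefl _ this

/-- An `a ∈ A` with `‖Φ(i a)‖ < 1`... conversely: if `‖Φ (i a)‖ = 1` detects units of `A`, then for
a unit-detected `a` with inverse `b`, `Φ(i b) · Φ(i a) = 1`. Bookkeeping form used below: from
`a * b = 1` get `Φ (i b) * Φ (i a) = 1`. [folklore] -/
theorem map_mul_map_eq_one_of_mul_eq_one {a b : A} (hab : a * b = 1) :
    Φ (i b) * Φ (i a) = 1 := by
  rw [← map_mul, ← map_mul, mul_comm, hab, map_one, map_one]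

/-! ### §2. The Jacobson radical of the order goes to the open unit ball -/

/-- Splitting a polynomial relation at an index `s ≤ d`:
`∑_{j ≤ d} c_j z^j = ∑_{j < s} c_j z^j + z^s · (c_s + z · ∑_{j < d - s} c_{s+1+j} z^j)`. [folklore] -/
theorem sum_range_succ_eq_split (c : ℕ → PadicAlgCl p) (z : PadicAlgCl p) {s d : ℕ} (hs : s ≤ d) :
    ∑ j ∈ Finset.range (d + 1), c j * z ^ j =
      ∑ j ∈ Finset.range s, c j * z ^ j +
        z ^ s * (c s + z * ∑ j ∈ Finset.range (d - s), c (s + 1 + j) * z ^ j) := by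
  obtain ⟨t, rfl⟩ := Nat.exists_eq_add_of_le hs
  rw [show s + t + 1 = s + (t + 1) by ring, Finset.sum_range_add, Nat.add_sub_cancel_left,
    Finset.sum_range_succ']
  congr 1
  simp only [add_zero]
  rw [mul_add, add_comm, Finset.mul_sum, Finset.mul_sum, mul_comm (z ^ s) (c s)]
  congr 1
  refine Finset.sum_congr rfl fun j _ ↦ ?_
  rw [show s + (j + 1) = s + 1 + j by ring]
  ring

/-- **The Jacobson radical of an order maps into the open unit ball.** Setting: `Φ : L → ℚ̄_p`,
`i : A → L` with `‖Φ(i a)‖ ≤ 1` for all `a` and `‖Φ(i a)‖ = 1 ⟹ a ∈ A^×`; `R ⊆ L` a subring of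
elements integral over `i(A)` containing `i(A)`. If `x ∈ R` is such that `1 + x·y` is a unit of `R`
for every `y ∈ R` (i.e. `x ∈ Jac(R)`), then `‖Φ x‖ < 1`. [folklore] -/
theorem norm_lt_one_of_forall_isUnit_one_add_mul (hA : ∀ a : A, ‖Φ (i a)‖ ≤ 1)
    (hAu : ∀ a : A, ‖Φ (i a)‖ = 1 → ∃ b : A, a * b = 1) (R : Subring L)
    (hR : ∀ x ∈ R, i.IsIntegralElem x) (hiR : ∀ a : A, i a ∈ R) {x : L} (hxR : x ∈ R)
    (hjac : ∀ y ∈ R, ∃ w ∈ R, (1 + x * y) * w = 1) : ‖Φ x‖ < 1 := by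
  have hx1 : ‖Φ x‖ ≤ 1 := norm_le_one_of_isIntegralElem hA (hR x hxR)
  by_contra hge
  have hz1 : ‖Φ x‖ = 1 := le_antisymm hx1 (not_lt.mp hge)
  set z := Φ x with hz
  -- the integrality relation, with `c_d = 1`
  obtain ⟨P, hP, hPx⟩ := hR x hxR
  set d := P.natDegree with hd
  let a : ℕ → A := fun j ↦ P.coeff j
  let c : ℕ → PadicAlgCl p := fun j ↦ Φ (i (a j))
  have hc1 : ∀ j, ‖c j‖ ≤ 1 := fun j ↦ hA _
  have hcd : c d = 1 := by
    change Φ (i (P.coeff P.natDegree)) = 1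
    rw [show P.coeff P.natDegree = 1 from hP, map_one, map_one]
  have hrel : ∑ j ∈ Finset.range (d + 1), c j * z ^ j = 0 := by
    have h := congrArg Φ hPx
    rw [eval₂_eq_sum_range, map_zero, map_sum] at h
    rw [← h]
    refine Finset.sum_congr rfl fun j _ ↦ ?_
    rw [map_mul, map_pow]
  -- the least index `s ≤ d` with `‖c_s‖ = 1`
  classical
  have hex : ∃ s, s ≤ d ∧ ‖c s‖ = 1 := ⟨d, le_rfl, by rw [hcd, norm_one]⟩
  let s := Nat.find hex
  have hs : s ≤ d ∧ ‖c s‖ = 1 := Nat.find_spec hex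
  have hlt : ∀ j < s, ‖c j‖ < 1 := by
    intro j hj
    have hmin := Nat.find_min hex hj
    rw [not_and] at hmin
    exact lt_of_le_of_ne (hc1 j) (hmin (hj.le.trans hs.1))
  -- the head `∑_{j<s}` is small, hence so is the tail `z^s (c_s + z w)`
  set w := ∑ j ∈ Finset.range (d - s), c (s + 1 + j) * z ^ j with hw
  have hhead : ‖∑ j ∈ Finset.range s, c j * z ^ j‖ < 1 := by
    refine norm_sum_lt_of_forall_lt _ _ one_pos fun j hj ↦ ?_
    rw [Finset.mem_range] at hj
    rw [norm_mul, norm_pow, hz1, one_pow, mul_one]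
    exact hlt j hj
  have htail : ‖c s + z * w‖ < 1 := by
    have h := sum_range_succ_eq_split c z hs.1
    rw [hrel] at h
    have h' : z ^ s * (c s + z * w) = -∑ j ∈ Finset.range s, c j * z ^ j :=
      (eq_neg_of_add_eq_zero_right h.symm)
    have : ‖z ^ s * (c s + z * w)‖ < 1 := by rw [h', norm_neg]; exact hhead
    rwa [norm_mul, norm_pow, hz1, one_pow, one_mul] at this
  -- `w = Φ W` with `W ∈ R`, and `a_s` is a unit of `A`
  set W : L := ∑ j ∈ Finset.range (d - s), i (a (s + 1 + j)) * x ^ j with hW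
  have hWR : W ∈ R := by
    refine Subring.sum_mem R fun j _ ↦ Subring.mul_mem R (hiR _) (Subring.pow_mem R hxR j)
  have hΦW : Φ W = w := by
    rw [hW, map_sum]
    refine Finset.sum_congr rfl fun j _ ↦ ?_
    rw [map_mul, map_pow]
  obtain ⟨b, hab⟩ := hAu (a s) hs.2
  -- Jacobson: `1 + x · (i b · W)` is a unit of `R`, so has norm `1` under `Φ` ...
  obtain ⟨w', hw'R, hw'⟩ := hjac (i b * W) (Subring.mul_mem R (hiR b) hWR)
  have hunit : ‖Φ (1 + x * (i b * W))‖ = 1 :=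
    norm_eq_one_of_mul_eq_one (norm_le_one_of_isIntegralElem hA (hR _
      (Subring.add_mem R (Subring.one_mem R) (Subring.mul_mem R hxR (Subring.mul_mem R (hiR b) hWR)))))
      (norm_le_one_of_isIntegralElem hA (hR w' hw'R)) hw'
  -- ... but it equals `Φ(i b) · (c_s + z w)`, of norm `< 1`
  have hfac : Φ (1 + x * (i b * W)) = Φ (i b) * (c s + z * w) := by
    rw [mul_add, map_mul_map_eq_one_of_mul_eq_one hab, map_add, map_one, map_mul, map_mul, hΦW,
      ← hz]
    ring
  have : ‖Φ (1 + x * (i b * W))‖ < 1 := by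
    rw [hfac, norm_mul]
    calc ‖Φ (i b)‖ * ‖c s + z * w‖ ≤ 1 * ‖c s + z * w‖ := by gcongr; exact hA b
      _ < 1 := by rw [one_mul]; exact htail
  rw [hunit] at this
  exact lt_irrefl _ this

end Order

/-! ### §3. Powers of an ideal: `‖Φ‖ ≤ ρ` on `J` gives `‖Φ‖ ≤ ρ^k` on `J^k` -/

section Powers

variable {R : Type*} [CommRing R] (Φ : R →+* PadicAlgCl p)

/-- **Norm decay on powers of an ideal**: if `‖Φ‖ ≤ 1` on `R` and `‖Φ x‖ ≤ ρ` for all `x ∈ J`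
(`0 ≤ ρ`) then `‖Φ x‖ ≤ ρ ^ k` for all `x ∈ J ^ k` (products multiply norms, sums are bounded by
the maximum). [folklore] -/
theorem norm_le_pow_of_mem_pow (h1 : ∀ x, ‖Φ x‖ ≤ 1) {J : Ideal R} {ρ : ℝ} (hρ : 0 ≤ ρ)
    (hJ : ∀ x ∈ J, ‖Φ x‖ ≤ ρ) : ∀ (k : ℕ), ∀ x ∈ J ^ k, ‖Φ x‖ ≤ ρ ^ k := by
  intro k
  induction k with
  | zero =>
    intro x _
    rw [pow_zero]
    exact h1 x
  | succ k ih =>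
    intro x hx
    rw [pow_succ'] at hx
    refine Submodule.mul_induction_on hx (fun m hm n hn ↦ ?_) (fun x y hx hy ↦ ?_)
    · rw [map_mul, norm_mul, pow_succ']
      exact mul_le_mul (hJ m hm) (ih n hn) (norm_nonneg _) hρ
    · rw [map_add]
      exact (IsUltrametricDist.norm_add_le_max _ _).trans (max_le hx hy)

end Powers

/-! ### §4. Discreteness: `‖z‖ < 1 ⟹ ‖z‖^{D} ≤ p⁻¹` in a `ℚ_p`-subalgebra of dimension `D` -/

section Discrete

/-- `‖z‖ < 1` in `ℚ̄_p` forces `‖z‖ ^ deg(minpoly_{ℚ_p} z) ≤ p⁻¹`: `‖z‖^{deg} = ‖a₀‖` lies in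
`p^ℤ ∪ {0}`. [folklore] -/
theorem norm_pow_natDegree_le_inv_of_norm_lt_one {z : PadicAlgCl p} (hz : ‖z‖ < 1) :
    ‖z‖ ^ (minpoly ℚ_[p] z).natDegree ≤ (p : ℝ)⁻¹ := by
  have hp : (1 : ℝ) < p := by exact_mod_cast (Fact.out : p.Prime).one_lt
  have hp0 : (0 : ℝ) < p := by positivity
  rw [IwasawaLog.norm_pow_natDegree_minpoly]
  by_cases h0 : (minpoly ℚ_[p] z).coeff 0 = 0
  · rw [h0, norm_zero]; positivity
  · have hlt : ‖(minpoly ℚ_[p] z).coeff 0‖ < 1 := by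
      rw [← IwasawaLog.norm_pow_natDegree_minpoly]
      exact pow_lt_one₀ (norm_nonneg _) hz
        (minpoly.natDegree_pos (Algebra.IsIntegral.isIntegral z)).ne'
    rw [Padic.norm_eq_zpow_neg_valuation h0] at hlt ⊢
    rw [← zpow_neg_one]
    refine zpow_le_zpow_right₀ hp.le ?_
    have : -((minpoly ℚ_[p] z).coeff 0).valuation < 0 := by
      by_contra hge
      rw [not_lt] at hge
      exact absurd hlt (not_lt.mpr (one_le_zpow₀ hp.le hge))
    omega

/-- **Discreteness of norms below `1` in a finite-dimensional `ℚ_p`-subalgebra of `ℚ̄_p`**: if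
`z ∈ S`, `dim_{ℚ_p} S = D` and `‖z‖ < 1` then `‖z‖ ^ D ≤ p⁻¹` (the degree of `z` over `ℚ_p` is at
most `D`). [folklore] -/
theorem norm_pow_finrank_le_inv_of_norm_lt_one (S : Subalgebra ℚ_[p] (PadicAlgCl p))
    [FiniteDimensional ℚ_[p] S] {z : PadicAlgCl p} (hzS : z ∈ S) (hz : ‖z‖ < 1) :
    ‖z‖ ^ finrank ℚ_[p] S ≤ (p : ℝ)⁻¹ := by
  have hdeg : (minpoly ℚ_[p] z).natDegree ≤ finrank ℚ_[p] S := by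
    have h := minpoly.natDegree_le (A := ℚ_[p]) (⟨z, hzS⟩ : S)
    rwa [← minpoly.algebraMap_eq (A := ℚ_[p]) (B' := PadicAlgCl p)
      (fun a b hab ↦ Subtype.ext hab : Function.Injective (algebraMap S (PadicAlgCl p)))
      (⟨z, hzS⟩ : S)] at h
  exact (pow_le_pow_of_le_one (norm_nonneg _) hz.le hdeg).trans
    (norm_pow_natDegree_le_inv_of_norm_lt_one hz)

end Discrete

end Summit.BirchSwinnertonDyer.BirchSwinnertonDyer.Theorems.PrintCf2.LeopoldtAtV

end
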